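import Summits.FinalStateConjecture.FinalStateConjecture.Theorems.ZeroEnergyKerrOrBombFinalStateFromKerrOrBombRecutPastBoundaryTimeScale
import Summits.FinalStateConjecture.FinalStateConjecture.Theorems.ZeroEnergyKerrOrBombFinalStateFromKerrOrBombRecutCoreBLorentz
import Summits.FinalStateConjecture.FinalStateConjecture.Theorems.ZeroEnergyKerrOrBombFinalStateFromKerrOrBombRecutCoreBDichotomy
import Summits.FinalStateConjecture.FinalStateConjecture.Theorems.ZeroEnergyKerrOrBombFinalStateFromKerrOrBombRecutCoreBFarFlat
import Summits.FinalStateConjecture.FinalStateConjecture.Theorems.ZeroEnergyKerrOrBombFinalStateFromKerrOrBombJunctionTimeFunctionKerr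
import Summits.FinalStateConjecture.FinalStateConjecture.Theorems.ZeroEnergyKerrOrBombFinalStateFromKerrOrBombRecutCoreCOTimeFunction
import Summits.FinalStateConjecture.FinalStateConjecture.Theorems.ZeroEnergyKerrOrBombFinalStateFromKerrOrBombRecutJunctionHoleTube
import Summits.FinalStateConjecture.FinalStateConjecture.Theorems.ZeroEnergyKerrOrBombFinalStateFromKerrOrBombRecutJunctionKerrDrsrUniform
import Summits.FinalStateConjecture.FinalStateConjecture.Theorems.ZeroEnergyKerrOrBombFinalStateFromKerrOrBombRecutJunctionHoleTubeErgo
import Summits.FinalStateConjecture.FinalStateConjecture.Theorems.ZeroEnergyKerrOrBombFinalStateFromKerrOrBombRecutCoreBNearHorizon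
import Summits.FinalStateConjecture.FinalStateConjecture.Theorems.ZeroEnergyKerrOrBombFinalStateFromKerrOrBombRecutCoreBFlatSteer
import Summits.FinalStateConjecture.FinalStateConjecture.Theorems.ZeroEnergyKerrOrBombFinalStateFromKerrOrBombRecutCoreBFlatSteer2
import Summits.FinalStateConjecture.FinalStateConjecture.Theorems.ZeroEnergyKerrOrBombFinalStateFromKerrOrBombRecutCoreBAssembly
import Summits.FinalStateConjecture.FinalStateConjecture.Theorems.ZeroEnergyKerrOrBombOneLockedExplosionDefs
import Summits.FinalStateConjecture.FinalStateConjecture.Statement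
import Literature.Geometry.Lorentzian.KerrTimelikeSpan
import HarnessLib

/-!
# Route ZeroEnergyKerrOrBomb · crux `FinalStateFromKerrOrBomb` (stmt-FinalStateConjecture-17839), line `SketchIdeator1` —
# stub `stub_recutJunctionCoreB` (m5, boost-honest junction core): the CLOSER `recutJunctionCoreB_holds`

UNCHECKED TODAY (W21, 2026-08-17): the thirteen imported brick modules are accepted but not yet built on the farm (`lean check`
rc 75 `remote:stale:…:unbuilt:…`), so this file cannot be elaborated or proposed yet. Its body is the kernel-checked glue of
`work/stubs/w21/ComposeCheck.lean` (rc 0, axioms standard) with each hypothesis `h_X` replaced by the accepted theorem of the same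
registered text: `recutJunction_c_eq_one` (p144329), `recutJunction_orthochronous`, `recutJunction_labTime_of_certified`,
`recutJunction_time_le_labTime`, `recutJunction_time_ge_of_labTime` (p153600), `recutJunction_time_le_labTime_sub`,
`lorentz_map_basisVector_of_apply_zero_eq_one` (p154132), `recutJunction_farFlat_deep` (p154085),
`junctionTimeFunction_boostedKerr` (p138474), `recutJunction_timeFunction_nearHorizon` (p149111),
`recutJunction_holeTube_far_slab` (p141608), `kerr_drsrVector_uniform`, `recutJunction_holeTube_rPlus_slab` (p141985),
`recutJunction_holeTube_ergo_slab` (p142035), `recutJunction_nearHorizon_of_timeFunction_boost` (p153531),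
`recutJunction_flatTimeLine_point`, `recutJunction_deepApproximant` (p156089), `recutJunction_flatSteer_boost` (p156202),
`recutJunction_holeSteer`, `recutJunctionCoreB_of_bricks` (p156218). Registered name: `recutJunctionCoreB_holds`
(`ledger workitem stub-add … --signature @work/stubs/sig-recutJunctionCoreB_holds.txt`, done). To land: `lean check` this file
once the modules build (probe: a 2-line file importing `…RecutCoreBLorentz`), then
`ledger propose --kind proof --target Summits/FinalStateConjecture/FinalStateConjecture/Theorems/ZeroEnergyKerrOrBombFinalStateFromKerrOrBombRecutCoreBHolds.lean --file work/stubs/RecutCoreB_Holds.lean --supports stmt-FinalStateConjecture-17839`;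
the skeleton then closes `stub_recutJunctionCoreB` by `exact recutJunctionCoreB_holds`.
Reference: Dafermos–Luk arXiv:1710.01722, Conjecture 1 (b)–(c) (late-time multi-chart bookkeeping; formalisation-internal).
-/

set_option linter.dupNamespace false
set_option maxHeartbeats 800000

noncomputable section

open scoped Manifold ContDiff Topology
open Set Filter Function

namespace Summit.FinalStateConjecture.FinalStateConjecture.Theorems.SymplecticDualOfTheBomb

open Literature.Geometry.Lorentzian Summit.FinalStateConjecture.FinalStateConjecture.Theorems.OneLockedExplosion

/-- **Registered closer `recutJunctionCoreB_holds`**: the unfolded text of `SigM.stub_recutJunctionCoreB` (boost-honest junction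
core, m5) from the accepted bricks of waves 3–8 (see the module docstring; plan `work/stubs/W17-boost-audit.md` §7.2).
Dafermos–Luk arXiv:1710.01722, Conjecture 1 (b)–(c). [folklore] -/
theorem recutJunctionCoreB_holds : ∀ (X : Type) [TopologicalSpace X] [ChartedSpace E3 X] [IsManifold (𝓡 3) ∞ X] [T2Space X] [SecondCountableTopology X] [ConnectedSpace X] (D : InitialDataSet (𝓡 3) X) (𝒟 : VacuumCauchyDevelopment D) (O : Set 𝒟.carrier) (d : StationaryFinalStateDecomposition 𝒟.toSpacetime O 2) (M a c r₀ : Fin d.N → ℝ) (Θ : Fin d.N → E4 → E4) (R : Fin d.N → ℝ → ℝ), O = Summit.FinalStateConjecture.exteriorOf 𝒟.toCauchyDevelopment d.charted → (∀ i, Tendsto (fun τ ↦ 𝒟.toSpacetime.truncDeviationCk (d.background i) (d.toOver.chart i) 2 (R i τ) τ) atTop (𝓝 0)) → (∀ i, Monotone (R i)) → (∀ i, Tendsto (R i) atTop atTop) → (∀ i, Tendsto (fun τ ↦ R i τ / τ) atTop (𝓝 0)) → (∀ i, ∀ W s₀ : ℝ, ∀ᶠ σ in atTop, d.toOver.chart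 i '' ({x | (d.background i).time x.1 = σ ∧ R i (σ - s₀) - W ≤ (d.background i).radius x.1 ∧ (d.background i).radius x.1 ≤ R i σ} ∩ docPart d i) ⊆ d.toOver.radiationZone) → (∀ W s₀ : ℝ, ∀ᶠ τ in atTop, ∀ y : E4, y 0 = τ → y ∉ (d.toOver.flatDomain : Set E4) → ∃ i, (d.background i).radius y ≤ R i ((d.background i).time y - s₀) - W) → (∀ τ₁ : ℝ, d.toOver.τ₀ < τ₁ → (O ∩ 𝒟.metric.chronologicalPast 𝒟.timeOrientation (docCharted d)) \ docCertifiedLate d R τ₁ ⊆ 𝒟.metric.causalPast 𝒟.timeOrientation (docCertifiedSlab d R τ₁)) → IsHorizonNormalised d → (∀ i, (d.hole i).horizon ⊆ Set.range (d.adapted i).toFun ∧ ChartIsAsymptoticallyCartesian (d.adapted i) ∧ InTelescope (d.hole i)) → (∀ i, IsKerrChartedWith (d.hole i) (d.adapted i) (M i) (a i) (c i) (r₀ i) (Θ i)) → (∀ i, ∀ u ∈ (Kerr.exterior (M i) (a i) : Set E4), ∀ h : Θ i u ∈ (d.adapted i).domain, (d.hole i).timeOrientation.IsFutureDirected (mfderiv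 𝓘(ℝ, E4) (𝓡 4) (d.adapted i).toFun ⟨Θ i u, h⟩ (fderiv ℝ (Θ i) u (Kerr.timeVector (M i) (a i) u)))) → (∀ (i : Fin d.N) (y : (d.background i).domain) (w : E4), d.toOver.τ₀ < (d.background i).time y.1 → (d.hole i).timeOrientation.IsFutureDirected (mfderiv 𝓘(ℝ, E4) (𝓡 4) (d.adapted i).toFun ⟨poincareInv (d.motion i).1 (d.motion i).2 y.1, ModelBackground.mem_boost_domain.1 y.2⟩ (((d.motion i).1 : E4 ≃L[ℝ] E4).symm w)) → 𝒟.metric.IsTimelike (mfderiv 𝓘(ℝ, E4) (𝓡 4) (d.toOver.chart i) y w) → 𝒟.timeOrientation.IsFutureDirected (mfderiv 𝓘(ℝ, E4) (𝓡 4) (d.toOver.chart i) y w)) → (∀ y : d.toOver.flatDomain, d.toOver.τ₀ < (y : E4) 0 → 𝒟.metric.IsTimelike (mfderiv 𝓘(ℝ, E4) (𝓡 4) d.toOver.flatChart y (E4.basisVector 0)) → 𝒟.timeOrientation.IsFutureDirected (mfderiv 𝓘(ℝ, E4) (𝓡 4) d.toOver.flatChart y (E4.basisVector 0))) → (∀ (i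 : Fin d.N) (y : (d.background i).domain) (h : (y : E4) ∈ d.toOver.flatDomain), d.toOver.τ₀ < (d.background i).time y.1 → d.toOver.τ₀ < (y : E4) 0 → (d.background i).radius y.1 ≤ R i ((d.background i).time y.1) → d.toOver.chart i y = d.toOver.flatChart ⟨y, h⟩) → (∀ (i : Fin d.N) (y : (d.background i).domain) (y' : d.toOver.flatDomain), d.toOver.τ₀ < (d.background i).time y.1 → (d.background i).radius y.1 ≤ R i ((d.background i).time y.1) → d.toOver.τ₀ < (y' : E4) 0 → d.toOver.chart i y = d.toOver.flatChart y' → (y : E4) = y') → (∀ y : d.toOver.flatDomain, d.toOver.τ₀ < (y : E4) 0 → ∀ i : Fin d.N, ∃ h : (y : E4) ∈ (d.background i).domain, (⟨(y : E4), h⟩ : (d.background i).domain) ∈ docPart d i) → (∀ i : Fin d.N, Tendsto (d.toOver.excision i) atTop atTop) → (∀ i : Fin d.N, ∃ T : ℝ, ∀ y : (d.background i).domain, T < (y : E4) 0 → (d.background i).radius y.1 ≤ d.toOver.excision i ((y : E4) 0) + 1 → d.toOver.τ₀ < (d.background i).time y.1) → (∀ (i : Fin d.N) (x : (d.background i).domain),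 x ∈ (d.background i).lateRegion d.toOver.τ₀ → x ∉ docPart d i → d.toOver.chart i x ∉ 𝒟.metric.causalPast 𝒟.timeOrientation d.toOver.radiationZone) → ∃ s₁ : ℝ, ∀ s W : ℝ, s₁ ≤ s → s₁ ≤ W → ∃ τJ : ℝ, ∀ τ₁ : ℝ, τJ < τ₁ → ((𝒟.metric.causalPast 𝒟.timeOrientation (docHoleSlabs d R τ₁) ∪ docHoleTubes d R τ₁) ∩ (O ∩ 𝒟.metric.chronologicalPast 𝒟.timeOrientation (docCharted d))) \ recutCertifiedLate d M a Θ (fun i τ ↦ R i (c i * τ - s) - W) τ₁ ⊆ 𝒟.metric.causalPast 𝒟.timeOrientation (recutCertifiedSlab d M a Θ (fun i τ ↦ R i (c i * τ - s) - W) τ₁) := by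
  intro X _ _ _ _ _ _ D 𝒟 O d M a c r₀ Θ R hO hRi hRmono hRtop hRo hRiii hRiiic hRii hnorm hreg hW hF5 hor₂ hor₃ hRa hRb he he' hℓ hn'
  have hc1 : ∀ i, c i = 1 := fun i ↦
    recutJunction_c_eq_one (d.hole i) (d.adapted i) (M i) (a i) (c i) (r₀ i) (Θ i) (hreg i).2.1 (hW i)
  have hγ := recutJunction_orthochronous d M a c r₀ Θ hW hc1 he' hℓ
  have hB1a : ∀ (i : Fin d.N) (ε : ℝ), 0 < ε → ∀ᶠ t in atTop, ∀ y : E4, (d.background i).time y = t →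
      (d.background i).radius y ≤ R i t → |y 0 - ((d.motion i).1 : E4 ≃L[ℝ] E4) (E4.basisVector 0) 0 * t| ≤ ε * t :=
    fun i ↦ recutJunction_labTime_of_certified d R i (hRo i)
  have hB1b := fun i ↦ recutJunction_time_le_labTime d R i (hRmono i) (hRo i) (hγ i)
  have hB1c := fun i Tstar ↦ recutJunction_time_ge_of_labTime d R i (hRmono i) (hγ i) Tstar
  have hdich : ∀ i : Fin d.N, ((d.motion i).1 : E4 ≃L[ℝ] E4) (E4.basisVector 0) = E4.basisVector 0 ∨
      ∀ K : ℝ, ∃ T : ℝ, ∀ y : E4, T ≤ y 0 → (d.background i).radius y ≤ R i ((d.background i).time y) →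
        (d.background i).time y ≤ y 0 - K := fun i ↦
    (hγ i).eq_or_lt.elim (fun h ↦ Or.inl (lorentz_map_basisVector_of_apply_zero_eq_one (d.motion i).1 h.symm)) fun h ↦
      Or.inr (recutJunction_time_le_labTime_sub d R i (hRmono i) (hRo i) h)
  have hB3 := recutJunction_farFlat_deep d M a c r₀ Θ R hRi hRmono hW hc1 hRa he' hℓ
  have hDA := recutJunction_deepApproximant d M a c r₀ Θ R hRmono hRiiic hW hRa he hB1b hB1c hB3
  have hHTF := recutJunction_timeFunction_nearHorizon d M a c r₀ Θ R hRi hRmono hRtop hW hc1 hF5 hor₂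
    junctionTimeFunction_boostedKerr
  have hfar : ∀ (i : Fin d.N) (δ : ℝ), 0 < δ → ∃ T : ℝ, ∀ (R' : Fin d.N → ℝ → ℝ) (τ₁ : ℝ),
      ∀ x ∈ (Kerr.exterior (M i) (a i) : Set E4), 2 * Kerr.scalarH (M i) (a i) x ≤ 1 - δ → T ≤ Θ i x 0 →
      (d.adapted i).radius (Θ i x) ≤ R i (Θ i x 0) → x 0 ≤ τ₁ → Kerr.radius (a i) x ≤ R' i τ₁ →
      ∀ h₀ : ((d.motion i).1 : E4 ≃L[ℝ] E4) (Θ i x) + (d.motion i).2 ∈ (d.background i).domain,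
        d.toOver.chart i ⟨((d.motion i).1 : E4 ≃L[ℝ] E4) (Θ i x) + (d.motion i).2, h₀⟩ ∈
          𝒟.metric.causalPast 𝒟.timeOrientation (recutCertifiedSlab d M a Θ R' τ₁) :=
    fun i δ hδ ↦ recutJunction_holeTube_far_slab d M a c r₀ Θ R hRi hRmono hW hF5 hor₂ i hδ
  have hunif : ∀ (i : Fin d.N) (δ Rm : ℝ), 0 < δ → ∃ m KV : ℝ, 0 < m ∧ 0 ≤ KV ∧ ∀ x : E4,
      Kerr.rPlus (M i) (a i) + δ ≤ Kerr.radius (a i) x → Kerr.radius (a i) x ≤ Rm →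
      Kerr.bilin (M i) (a i) x (Kerr.drsrVector (M i) (a i) x) (Kerr.drsrVector (M i) (a i) x) ≤ -m ∧
      ‖Kerr.drsrVector (M i) (a i) x‖ ≤ KV := fun i δ Rm hδ ↦ kerr_drsrVector_uniform (M i) (a i) (hW i).1 δ Rm hδ
  have hergo := recutJunction_holeTube_ergo_slab d M a c r₀ Θ R hRi hRmono hRtop hW hF5 hor₂ hunif
  have hα := recutJunction_holeTube_rPlus_slab d M a c r₀ Θ R hW hfar hergo
  have hNH := recutJunction_nearHorizon_of_timeFunction_boost d M a c r₀ Θ R hRtop hW hc1 hnorm hRb hn' hα hHTF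
  have hHS := recutJunction_holeSteer d M a Θ R hα hNH
  have hline := recutJunction_flatTimeLine_point d hor₃
  have hF := recutJunction_flatSteer_boost d M a c r₀ Θ R hRmono hRtop hW hc1 hRa hdich hline hHS hDA
  exact recutJunctionCoreB_of_bricks d M a c r₀ Θ R hRmono hRtop hRiii hRii hW hc1 hγ hRb hB1a hHS hF

end Summit.FinalStateConjecture.FinalStateConjecture.Theorems.SymplecticDualOfTheBomb

end
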